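import Summits.Ventures.Crystal3D.Kissing125.GSearchNode2
import HarnessLib

/-!
# Soundness of the node rule and of propagation, κ-generic — part 3/3

HONEST FRAMING (cell pub-crystal3d, K-path at `h = 5/4`, V4 = κ as an explicit parameter): this is NOT a result printed
by Hales; it is his METHOD (arXiv:1209.6043, Theorem 3 + Lemmas 7–10, in the tree's form of a verified interval-arithmetic
growth search, `Literature/…/KissingSearch*.lean`) with the largest long-side cosine `κ` made an EXPLICIT PARAMETER
(`κ : Kappa`, carrying the two numeric facts the soundness proof uses: `-1/2 ≤ κ`, `κ < 1/4`).  Only the declarations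
whose statement depends on `κ` are declared here (namespace `…Kissing125.GSearch`, the tree's short names, no renames);
every κ-free helper is the landed K25 copy (`…Kissing125.KissingSearch.*`) and every κ-free lemma is cited from the tree
(PRIVATE per-file citation aliases; `GSearchTransport.lean` holds `toT : St → tree St` and the transport equalities).  The K25
instance is `κ25 = ⟨7/32, …⟩`; `GSearchBridge.lean` identifies the generic checker at
`κ25` with the landed `Kissing125.KissingSearch.checkPart`, so the landed run files are consumed unchanged.  Generated by
`HOME/lean/kissing125/v4-prep/gen/mkgen.py`; nothing here is asserted about GAP(1.26) or any census.

THIS FILE: the κ-tainted declarations of `Literature/Geometry/DiscreteGeometry/KissingSearchNode.lean` (part 3 of 3), with `κ : Kappa` threaded; κ-free declarations of that file are NOT re-declared publicly (the κ-free helpers are the landed K25 copies; the κ-free tree lemmas used by the proofs are cited through PRIVATE aliases at the top of the file).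

## References
* T. C. Hales, *A proof of Fejes Tóth's conjecture on sphere packings with kissing number twelve*,
  arXiv:1209.6043 (2012): Definition 1, Theorem 2, Theorem 3, Lemmas 7–10. [`Hales2012`]
* R. E. Moore, *Interval Analysis* (1966), Theorem 3.1, §4.4. [`Moore1966`]
-/

namespace Summit.Ventures.Crystal3D.Kissing125

open Literature.Geometry.DiscreteGeometry
open Summit.Ventures.Crystal3D.Kissing125.KissingSearch

namespace GSearch

open Real Literature.Analysis.ValidatedNumerics KissingLP NonemptyInterval Finset

variable {κ : Kappa}

/-! ### κ-free tree lemmas used below, read over the K25 copies (PRIVATE citation aliases; the public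
surface of this file is κ-generic only) -/

/-- K25 reading of the tree lemma `TWOPI_LO_mul_lt` (κ-free; proof = citation of the tree lemma). [folklore] -/
private theorem TWOPI_LO_mul_lt : (↑TWOPI_LO : ℝ) * (↑δ : ℝ) < 2 * π :=
  Literature.Geometry.DiscreteGeometry.KissingSearch.TWOPI_LO_mul_lt

/-- K25 reading of the tree lemma `delta_pos` (κ-free; proof = citation of the tree lemma). [folklore] -/
private theorem delta_pos : 0 < (↑δ : ℝ) :=
  Literature.Geometry.DiscreteGeometry.KissingSearch.delta_pos

/-- K25 reading of the tree lemma `linkSummary_eq` (κ-free; proof = citation of the tree lemma). [folklore] -/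
private theorem linkSummary_eq (s : St) (v : ℕ) :
  s.linkSummary v =
    ((List.filter (fun u ↦ decide (u ≠ v ∧ s.gsc v u ≠ 0)) (List.range' 0 12)).length,
      (List.filter (fun u ↦ decide (u ≠ v ∧ s.gsc v u = 1)) (List.range' 0 12)).length,
      (List.range' 0 12).any fun u ↦ decide (u ≠ v ∧ 3 ≤ s.gsc v u),
      (List.filter (fun u ↦ decide (u ≠ v ∧ s.gsc v u ≠ 0)) (List.range' 0 12)).reverse) :=
  by rw [linkSummary_tr]; exact Literature.Geometry.DiscreteGeometry.KissingSearch.linkSummary_eq (toT s) v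

/-- K25 reading of the tree lemma `lt_TWOPI_HI_mul` (κ-free; proof = citation of the tree lemma). [folklore] -/
private theorem lt_TWOPI_HI_mul : 2 * π < (↑TWOPI_HI : ℝ) * (↑δ : ℝ) :=
  Literature.Geometry.DiscreteGeometry.KissingSearch.lt_TWOPI_HI_mul

/-- K25 reading of the tree lemma `mem_trisAt` (κ-free; proof = citation of the tree lemma). [folklore] -/
private theorem mem_trisAt {s : St} {v t : ℕ} :
  t ∈ s.trisAt v ↔ t ∈ s.tris.toList ∧ tmem t v = true :=
  Literature.Geometry.DiscreteGeometry.KissingSearch.mem_trisAt (s := toT s)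

/-- K25 reading of the tree lemma `tmem_iff` (κ-free; proof = citation of the tree lemma). [folklore] -/
private theorem tmem_iff {t v : ℕ} : tmem t v = true ↔ v ∈ tset t :=
  Literature.Geometry.DiscreteGeometry.KissingSearch.tmem_iff


section Node
variable {M : KConf κ} {s : St}
/-- Lower and upper bracket sums bound the list angle sum. [folklore] -/
theorem bracket_sums_bound (hR : Realizes M s) (v : ℕ) (L : List ℕ) (hL : ∀ t ∈ L, t ∈ s.trisAt v) :
    (((L.map fun t => brLo (St.slotBr κ s t v)).sum : ℕ) : ℝ) * (δ : ℝ) ≤ (L.map fun t => M.ang (tset t) v).sum ∧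
      (L.map fun t => M.ang (tset t) v).sum ≤ (((L.map fun t => brHi (St.slotBr κ s t v)).sum : ℕ) : ℝ) * (δ : ℝ) := by
  induction L with
  | nil => simp
  | cons t L ih =>
    obtain ⟨i1, i2⟩ := ih (fun t' ht' => hL t' (by simp [ht']))
    have ht := mem_trisAt.1 (hL t (by simp))
    obtain ⟨-, hlo, hhi⟩ := slot_encl hR ht.1 (tmem_iff.1 ht.2)
    simp only [List.map_cons, List.sum_cons, Nat.cast_add, add_mul]
    exact ⟨add_le_add hlo i1, add_le_add hhi i2⟩

/-- **The window of a slot at a closed label contains its angle.** [cite: Moore1966, §4.4] -/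
theorem window_of_closed (hR : Realizes M s) {v : ℕ} (hv : v < 12)
    (hne : ∀ u, u < 12 → u ≠ v → s.gsc v u ≠ 1) {t : ℕ} (ht : t ∈ s.trisAt v) {sl sh : ℕ}
    (hsl : sl = ((s.trisAt v).map fun t => brLo (St.slotBr κ s t v)).sum)
    (hsh : sh = ((s.trisAt v).map fun t => brHi (St.slotBr κ s t v)).sum) :
    ((TWOPI_LO - (sh - brHi (St.slotBr κ s t v)) : ℕ) : ℝ) * (δ : ℝ) ≤ M.ang (tset t) v ∧
      M.ang (tset t) v ≤ ((TWOPI_HI - (sl - brLo (St.slotBr κ s t v)) : ℕ) : ℝ) * (δ : ℝ) := by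
  classical
  have htl := mem_trisAt.1 ht
  have hsum := sum_ang_trisAt_of_closed hR hv hne ⟨t, htl.1, tmem_iff.1 htl.2⟩
  -- split the list at `t`
  obtain ⟨l₁, l₂, hsplit⟩ := List.append_of_mem ht
  have hrest : ∀ t' ∈ l₁ ++ l₂, t' ∈ s.trisAt v := by
    intro t' ht'; rw [hsplit]; rw [List.mem_append] at ht' ⊢
    rcases ht' with h | h
    · exact Or.inl h
    · exact Or.inr (List.mem_cons_of_mem _ h)
  obtain ⟨rlo, rhi⟩ := bracket_sums_bound hR v (l₁ ++ l₂) hrest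
  -- sums decompose
  have eA : ((s.trisAt v).map fun t => M.ang (tset t) v).sum =
      M.ang (tset t) v + ((l₁ ++ l₂).map fun t => M.ang (tset t) v).sum := by
    rw [hsplit]; simp only [List.map_append, List.map_cons, List.sum_append, List.sum_cons]; ring
  have eL : sl = brLo (St.slotBr κ s t v) + ((l₁ ++ l₂).map fun t => brLo (St.slotBr κ s t v)).sum := by
    rw [hsl, hsplit]; simp only [List.map_append, List.map_cons, List.sum_append, List.sum_cons]; ring
  have eH : sh = brHi (St.slotBr κ s t v) + ((l₁ ++ l₂).map fun t => brHi (St.slotBr κ s t v)).sum := by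
    rw [hsh, hsplit]; simp only [List.map_append, List.map_cons, List.sum_append, List.sum_cons]; ring
  set R := ((l₁ ++ l₂).map fun t => M.ang (tset t) v).sum with hRdef
  set RL := ((l₁ ++ l₂).map fun t => brLo (St.slotBr κ s t v)).sum with hRL
  set RH := ((l₁ ++ l₂).map fun t => brHi (St.slotBr κ s t v)).sum with hRH
  have hθ : M.ang (tset t) v = 2 * π - R := by linarith
  have h2lo := TWOPI_LO_mul_lt
  have h2hi := lt_TWOPI_HI_mul
  have hδ := delta_pos
  obtain ⟨-, ownlo, ownhi⟩ := slot_encl hR htl.1 (tmem_iff.1 htl.2)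
  constructor
  · -- lower window
    have esub : sh - brHi (St.slotBr κ s t v) = RH := by rw [eH]; omega
    rw [esub]
    by_cases hle : RH ≤ TWOPI_LO
    · rw [Nat.cast_sub hle, sub_mul]; linarith
    · rw [Nat.sub_eq_zero_of_le (by omega : TWOPI_LO ≤ RH)]; simp [M.ang_nonneg]
  · -- upper window
    have esub : sl - brLo (St.slotBr κ s t v) = RL := by rw [eL]; omega
    rw [esub]
    by_cases hle : RL ≤ TWOPI_HI
    · rw [Nat.cast_sub hle, sub_mul]; linarith
    · exfalso
      have : ((TWOPI_HI : ℕ) : ℝ) * (δ : ℝ) < (RL : ℝ) * (δ : ℝ) :=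
        mul_lt_mul_of_pos_right (by exact_mod_cast (not_le.1 hle)) hδ
      have hR0 : 0 ≤ M.ang (tset t) v := M.ang_nonneg _ _
      linarith

/-- **Soundness of `nodeRule`.** [cite: Hales2012, proof of Lemma 9 (node equations)] -/
theorem nodeRule_sound (hR : Realizes M s) {v : ℕ} (hv : v < 12) :
    St.nodeRule κ s v ≠ none ∧ ∀ s', St.nodeRule κ s v = some s' → Realizes M s' ∧ s'.tris = s.tris := by
  classical
  have hbad := not_badLink hR hv
  unfold St.nodeRule
  -- destructure the summary
  rw [show s.linkSummary v = ((s.linkSummary v).1, (s.linkSummary v).2.1, (s.linkSummary v).2.2.1,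
    (s.linkSummary v).2.2.2) from rfl]
  simp only
  rw [hbad]
  have hLS := linkSummary_eq s v
  have e1 : (s.linkSummary v).1 = ((List.range' 0 12).filter fun u => u ≠ v ∧ s.gsc v u ≠ 0).length := by
    rw [hLS]
  have e2 : (s.linkSummary v).2.1 = ((List.range' 0 12).filter fun u => u ≠ v ∧ s.gsc v u = 1).length := by
    rw [hLS]
  by_cases hnv : (s.linkSummary v).1 = 0
  · rw [if_pos hnv]; exact ⟨by simp, fun s' h => by cases h; exact ⟨hR, rfl⟩⟩
  · rw [if_neg hnv]
    simp only [Bool.false_eq_true, ↓reduceIte]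
    -- slots are feasible
    have hfeas : ∀ t ∈ s.trisAt v, St.slotBr κ s t v ≠ NOBR := fun t ht =>
      (slot_encl hR (mem_trisAt.1 ht).1 (tmem_iff.1 (mem_trisAt.1 ht).2)).1
    rw [slotSums_eq_some s v _ hfeas]
    simp only
    set sl := ((s.trisAt v).map fun t => brLo (St.slotBr κ s t v)).sum with hsl
    set sh := ((s.trisAt v).map fun t => brHi (St.slotBr κ s t v)).sum with hsh
    obtain ⟨blo, bhi⟩ := bracket_sums_bound hR v (s.trisAt v) (fun t ht => ht)
    -- a placed triangle at `v` (from `nv ≠ 0`)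
    have hex : ∃ t ∈ s.tris.toList, v ∈ tset t := by
      rw [e1] at hnv
      obtain ⟨u, hu⟩ := List.exists_mem_of_ne_nil ((List.range' 0 12).filter fun u => u ≠ v ∧ s.gsc v u ≠ 0)
        (fun h => hnv (by rw [h]; rfl))
      simp only [List.mem_filter, List.mem_range'_1, decide_eq_true_eq] at hu
      obtain ⟨hu12, huv, hg⟩ := hu
      rw [gsc_eq_length hR hv (by omega) (Ne.symm huv)] at hg
      obtain ⟨t, ht⟩ := List.exists_mem_of_ne_nil (s.onSideL v u) (fun h => hg (by rw [h]; rfl))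
      unfold St.onSideL at ht; rw [List.mem_filter] at ht; simp only [Bool.and_eq_true] at ht
      exact ⟨t, ht.1, tmem_iff.1 ht.2.1⟩
    by_cases hne0 : (s.linkSummary v).2.1 = 0
    · -- closed label
      rw [if_pos hne0]
      have hne : ∀ u, u < 12 → u ≠ v → s.gsc v u ≠ 1 := by
        intro u hu huv h1
        rw [e2] at hne0
        have : u ∈ (List.range' 0 12).filter (fun u => u ≠ v ∧ s.gsc v u = 1) := by
          simp only [List.mem_filter, List.mem_range'_1, decide_eq_true_eq]; exact ⟨by omega, huv, h1⟩
        rw [List.length_eq_zero_iff.1 hne0] at this; simp at this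
      have hsum := sum_ang_trisAt_of_closed hR hv hne hex
      have h2lo := TWOPI_LO_mul_lt
      have h2hi := lt_TWOPI_HI_mul
      have hδ := delta_pos
      have hkill : ¬ (TWOPI_HI ≤ sl ∨ sh < TWOPI_LO) := by
        rintro (h | h)
        · have : ((TWOPI_HI : ℕ) : ℝ) * (δ : ℝ) ≤ (sl : ℝ) * δ := mul_le_mul_of_nonneg_right (by exact_mod_cast h) hδ.le
          linarith
        · have : ((sh : ℕ) : ℝ) * (δ : ℝ) < (TWOPI_LO : ℝ) * δ := mul_lt_mul_of_pos_right (by exact_mod_cast h) hδ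
          linarith
      rw [if_neg hkill]
      -- the trims
      unfold St.trimAt
      have gen : ∀ (L : List ℕ), (∀ t ∈ L, t ∈ s.trisAt v) → ∀ (s1 : St), Realizes M s1 → s1.tris = s.tris →
          (L.foldl (fun os t => match os with
            | none => none
            | some s1 =>
              let br := St.slotBr κ s t v
              if br = NOBR then none
              else
                let wlo := TWOPI_LO - (sh - brHi br)
                let whi := TWOPI_HI - (sl - brLo br)
                match St.trimSide κ s1 t v 0 wlo whi with
                | none => none
                | some s2 => match St.trimSide κ s2 t v 1 wlo whi with
                  | none => none
                  | some s3 => St.trimSide κ s3 t v 2 wlo whi) (some s1)) ≠ none ∧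
          ∀ s', (L.foldl (fun os t => match os with
            | none => none
            | some s1 =>
              let br := St.slotBr κ s t v
              if br = NOBR then none
              else
                let wlo := TWOPI_LO - (sh - brHi br)
                let whi := TWOPI_HI - (sl - brLo br)
                match St.trimSide κ s1 t v 0 wlo whi with
                | none => none
                | some s2 => match St.trimSide κ s2 t v 1 wlo whi with
                  | none => none
                  | some s3 => St.trimSide κ s3 t v 2 wlo whi) (some s1)) = some s' →
            Realizes M s' ∧ s'.tris = s.tris := by
        intro L
        induction L with
        | nil => intro _ s1 hs1 htr; simp [hs1, htr]
        | cons t L ih =>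
          intro hL s1 hs1 htr
          rw [List.foldl_cons]
          have ht := hL t (by simp)
          have htl := mem_trisAt.1 ht
          simp only [hfeas t ht, ↓reduceIte]
          have hw := window_of_closed hR hv hne ht hsl hsh
          have hvt : v ∈ tset t := tmem_iff.1 htl.2
          obtain ⟨n1, k1⟩ := trimSide_sound hs1 (by rw [htr]; exact htl.1) hvt 0 _ _ hw
          obtain ⟨s2, es2⟩ := Option.ne_none_iff_exists'.1 n1
          obtain ⟨hs2, t2, -⟩ := k1 s2 es2
          simp only [es2]
          obtain ⟨n2, k2⟩ := trimSide_sound hs2 (by rw [t2, htr]; exact htl.1) hvt 1 _ _ hw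
          obtain ⟨s3, es3⟩ := Option.ne_none_iff_exists'.1 n2
          obtain ⟨hs3, t3, -⟩ := k2 s3 es3
          simp only [es3]
          obtain ⟨n3, k3⟩ := trimSide_sound hs3 (by rw [t3, t2, htr]; exact htl.1) hvt 2 _ _ hw
          obtain ⟨s4, es4⟩ := Option.ne_none_iff_exists'.1 n3
          obtain ⟨hs4, t4, -⟩ := k3 s4 es4
          rw [es4]
          exact ih (fun t' ht' => hL t' (by simp [ht'])) s4 hs4 (by rw [t4, t3, t2, htr])
      exact gen _ (fun t ht => ht) s hR rfl
    · -- open label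
      rw [if_neg hne0]
      have hkill : ¬ TWOPI_HI ≤ sl + THMIN κ := by
        intro h
        rw [e2] at hne0
        obtain ⟨u, hu⟩ := List.exists_mem_of_ne_nil ((List.range' 0 12).filter fun u => u ≠ v ∧ s.gsc v u = 1)
          (fun h' => hne0 (by rw [h']; rfl))
        simp only [List.mem_filter, List.mem_range'_1, decide_eq_true_eq] at hu
        obtain ⟨hu12, huv, h1⟩ := hu
        obtain ⟨t'', hT, hv'', -, hun⟩ := exists_unplaced_of_gsc_one hR hv (by omega) huv.symm h1
        have hle := sum_ang_trisAt_add_le hR hv hT hv'' hun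
        have hth := THMIN_mul_le_ang M hT hv''
        have h2hi := lt_TWOPI_HI_mul
        have hδ := delta_pos
        have : ((TWOPI_HI : ℕ) : ℝ) * (δ : ℝ) ≤ ((sl + THMIN κ : ℕ) : ℝ) * δ :=
          mul_le_mul_of_nonneg_right (by exact_mod_cast h) hδ.le
        rw [Nat.cast_add, add_mul] at this
        linarith
      rw [if_neg hkill]
      exact ⟨by simp, fun s' h => by cases h; exact ⟨hR, rfl⟩⟩

end Node

/-! ### Part D. Local steps and propagation -/

section Propagation

variable {M : KConf κ} {s : St}

/-- **Soundness of `localStep`.** [folklore] -/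
theorem localStep_sound (hR : Realizes M s) {v : ℕ} (hv : v < 12) :
    St.localStep κ s v ≠ none ∧ ∀ s', St.localStep κ s v = some s' → Realizes M s' ∧ s'.tris = s.tris := by
  unfold St.localStep
  obtain ⟨n1, k1⟩ := trimTrisAt_sound hR v
  obtain ⟨s1, e1⟩ := Option.ne_none_iff_exists'.1 n1
  obtain ⟨hs1, t1⟩ := k1 s1 e1
  simp only [e1]
  obtain ⟨n2, k2⟩ := pairRulesAt_sound hs1 hv
  obtain ⟨s2, e2⟩ := Option.ne_none_iff_exists'.1 n2
  obtain ⟨hs2, t2⟩ := k2 s2 e2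
  simp only [e2]
  obtain ⟨n3, k3⟩ := nodeRule_sound hs2 hv
  exact ⟨n3, fun s' h => let ⟨q1, q2⟩ := k3 s' h; ⟨q1, by rw [q2, t2, t1]⟩⟩

/-- **Soundness of `propagateWL`**: propagation never kills a realized state and keeps it
realized (with the same triangles). [cite: Moore1966, §4.4] -/
theorem propagateWL_sound : ∀ (fuel : ℕ) (dirty : List ℕ) (s : St), Realizes M s →
    St.propagateWL κ s fuel dirty ≠ none ∧ ∀ s', St.propagateWL κ s fuel dirty = some s' → Realizes M s' ∧ s'.tris = s.tris
  | 0, dirty, s, hR => by unfold St.propagateWL; simp [hR]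
  | fuel + 1, [], s, hR => by unfold St.propagateWL; simp [hR]
  | fuel + 1, v :: rest, s, hR => by
    unfold St.propagateWL
    by_cases hv : 12 ≤ v
    · rw [if_pos hv]; exact propagateWL_sound fuel rest s hR
    · rw [if_neg hv]
      obtain ⟨n1, k1⟩ := localStep_sound hR (not_le.1 hv)
      obtain ⟨s1, e1⟩ := Option.ne_none_iff_exists'.1 n1
      obtain ⟨hs1, t1⟩ := k1 s1 e1
      simp only [e1]
      obtain ⟨n2, k2⟩ := propagateWL_sound fuel _ s1 hs1
      exact ⟨n2, fun s' h => let ⟨q1, q2⟩ := k2 s' h; ⟨q1, q2.trans t1⟩⟩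

/-- **Soundness of `propagate`.** [folklore] -/
theorem propagate_sound (hR : Realizes M s) (fuel : ℕ) :
    St.propagate κ s fuel ≠ none ∧ ∀ s', St.propagate κ s fuel = some s' → Realizes M s' ∧ s'.tris = s.tris :=
  propagateWL_sound fuel _ s hR

end Propagation


end GSearch

end Summit.Ventures.Crystal3D.Kissing125
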